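import Literature.MathematicalPhysics.QuantumFieldTheory.WilsonFinTorusPartitionComplex
import HarnessLib

/-!
# Axis symmetry and volume bounds of the Wilson partition function of the anisotropic four-torus

Infrastructure about `wilsonFinTorusPartition ρ β n₀ n₁ n₂ n₃` (`WilsonFinTorusPartition.lean`: the Wilson
partition function of the `Fin`-indexed periodic torus `n₀ × n₁ × n₂ × n₃`, product Haar measure on the links,
weight `exp(−β S)`, `S = Σ_x Σ_{μ<ν} (n − Re tr ρ(U_{x,μν}))`), for a continuous finite-dimensional representation
`ρ` of a compact group `G`:

* `wilsonFinTorusPartition_relabel` — **axis relabelling**: every bijection of sites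
  `e : FinTorusSite a b c d ≃ FinTorusSite a' b' c' d'` that intertwines the nearest-neighbour shifts along a
  permutation `σ` of the four axes (`e (x + e_μ) = e x + e_{σ μ}`) preserves the partition function.  Proof: the
  induced relabelling of the links `(x, μ) ↦ (e x, σ μ)` preserves the product Haar measure
  (`measurePreserving_arrowCongr'`) and carries the plaquette `(x; μ, ν)` to the plaquette `(e x; σ μ, σ ν)`,
  traversed backwards when `σ` reverses the order of `μ < ν`; a plaquette traversed backwards has the inverse
  holonomy and `Re tr ρ(g⁻¹) = Re tr ρ(g)` (compactness), so the action is invariant.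
  [cite: MontvayMunster1994, §3.2.6 (3.145)]
* `wilsonFinTorusPartition_swap03 / _swap01 / _swap02` and the packaged `wilsonFinTorusPartition_axisSymmetric`:
  `Z(a,b,c,d) = Z(d,b,c,a) = Z(b,a,c,d) = Z(c,b,a,d)` — the three transpositions of the arguments (they generate
  `S₄`); in particular every axis may be read as Euclidean time, so the transfer-matrix trace formula of
  `WilsonFinTorusPartition` holds in every direction (Osterwalder–Seiler: reflection positivity in all axes).
  [cite: MontvayMunster1994, §3.2.6 (3.145)]
* `wilsonFinTorusPartition_le_one_of_nonneg`, `exp_neg_le_wilsonFinTorusPartition`,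
  `wilsonFinTorusPartition_volumeBounds` — **stability bounds** `exp(−12 n β · n₀n₁n₂n₃) ≤ Z ≤ 1` for `β ≥ 0`:
  each of the `6 · n₀n₁n₂n₃` plaquette terms satisfies `0 ≤ n − Re tr ρ(U_p) ≤ 2n` (`|Re tr ρ| ≤ n` for a
  continuous representation of a compact group), and the links carry a probability measure.
  [cite: MontvayMunster1994, §3.2.2 (3.65)–(3.69) (Wilson action, one orientation per plaquette, "real and positive")]

These are the support statements [Sym] and [Vol] used by aspect-ratio / transfer-matrix bootstraps on the
anisotropic torus; everything here is proved, no definitions, no named facts.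

## References

* I. Montvay, G. Münster, *Quantum Fields on a Lattice* (1994), §3.2.6 (3.145) (`Z = Tr 𝕋^T` on the periodic
  lattice, any axis as time).
* K. Osterwalder, E. Seiler, Ann. Phys. 110 (1978) 440, §§2–3.
-/

noncomputable section

open scoped BigOperators
open MeasureTheory Finset
open Literature.RepresentationTheory.CompactGroups

namespace Literature.MathematicalPhysics.QuantumFieldTheory

variable {G : Type*} [Group G] {n : ℕ}

/-! ### Plaquettes under relabelling (pure algebra) -/

section Algebra

/-- The plaquette traversed in the opposite orientation has the inverse holonomy. [folklore] -/
private theorem finTorusPlaquette_symm {n₀ n₁ n₂ n₃ : ℕ} (U : FinTorusSite n₀ n₁ n₂ n₃ × Fin 4 → G)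
    (x : FinTorusSite n₀ n₁ n₂ n₃) (μ ν : Fin 4) :
    finTorusPlaquette U x ν μ = (finTorusPlaquette U x μ ν)⁻¹ := by
  unfold finTorusPlaquette
  group

/-- **Plaquettes of a relabelled configuration**: if `e` intertwines the shifts along the axis permutation
`σ`, the plaquette `(x; μ, ν)` of the pulled-back configuration `(x, μ) ↦ U'(e x, σ μ)` is the plaquette
`(e x; σ μ, σ ν)` of `U'`. [folklore] -/
private theorem finTorusPlaquette_relabel {a b c d a' b' c' d' : ℕ} (e : FinTorusSite a b c d ≃ FinTorusSite a' b' c' d')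
    (σ : Equiv.Perm (Fin 4)) (he : ∀ x μ, e (x.shift μ) = (e x).shift (σ μ))
    (U' : FinTorusSite a' b' c' d' × Fin 4 → G) (x : FinTorusSite a b c d) (μ ν : Fin 4) :
    finTorusPlaquette (fun l : FinTorusSite a b c d × Fin 4 => U' (e l.1, σ l.2)) x μ ν =
      finTorusPlaquette U' (e x) (σ μ) (σ ν) := by
  simp only [finTorusPlaquette, he]

/-- The sum over the ordered pairs `μ < ν` of `Fin 4`, written out. [folklore] -/
private theorem sum_pairs_eq_six (g : Fin 4 → Fin 4 → ℝ) :
    ∑ q : {q : Fin 4 × Fin 4 // q.1 < q.2}, g q.1.1 q.1.2 =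
      g 0 1 + g 0 2 + g 0 3 + g 1 2 + g 1 3 + g 2 3 := by
  have h := Finset.sum_subtype (p := fun q : Fin 4 × Fin 4 => q.1 < q.2) (F := inferInstance)
    (Finset.univ.filter fun q : Fin 4 × Fin 4 => q.1 < q.2) (fun x => by simp)
    (fun q : Fin 4 × Fin 4 => g q.1 q.2)
  rw [← h, Finset.sum_filter, Fintype.sum_prod_type]
  simp (config := { decide := true }) only [Fin.sum_univ_four, Fin.isValue, ite_true, ite_false, add_zero,
    zero_add, add_assoc]

/-- Twice the sum over pairs of a symmetric function is the off-diagonal sum. [folklore] -/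
private theorem two_mul_sum_pairs (g : Fin 4 → Fin 4 → ℝ) (hg : ∀ μ ν, g ν μ = g μ ν) :
    2 * ∑ q : {q : Fin 4 × Fin 4 // q.1 < q.2}, g q.1.1 q.1.2 = (∑ μ, ∑ ν, g μ ν) - ∑ μ, g μ μ := by
  rw [sum_pairs_eq_six g]
  simp only [Fin.sum_univ_four]
  rw [hg 0 1, hg 0 2, hg 0 3, hg 1 2, hg 1 3, hg 2 3]
  ring

/-- **The sum over plaquette orientations is invariant under a permutation of the axes** for a function
symmetric in its two directions. [folklore] -/
private theorem sum_pairs_perm (f : Fin 4 → Fin 4 → ℝ) (hf : ∀ μ ν, f ν μ = f μ ν) (σ : Equiv.Perm (Fin 4)) :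
    ∑ q : {q : Fin 4 × Fin 4 // q.1 < q.2}, f (σ q.1.1) (σ q.1.2) =
      ∑ q : {q : Fin 4 × Fin 4 // q.1 < q.2}, f q.1.1 q.1.2 := by
  have h1 : 2 * ∑ q : {q : Fin 4 × Fin 4 // q.1 < q.2}, f (σ q.1.1) (σ q.1.2) =
      (∑ μ, ∑ ν, f (σ μ) (σ ν)) - ∑ μ, f (σ μ) (σ μ) :=
    two_mul_sum_pairs (fun μ ν => f (σ μ) (σ ν)) (fun μ ν => hf (σ μ) (σ ν))
  have h2 := two_mul_sum_pairs f hf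
  have h3 : (∑ μ, ∑ ν, f (σ μ) (σ ν)) = ∑ μ, ∑ ν, f μ ν :=
    calc (∑ μ, ∑ ν, f (σ μ) (σ ν)) = ∑ μ, ∑ ν, f μ (σ ν) :=
          Equiv.sum_comp σ (fun μ => ∑ ν, f μ (σ ν))
      _ = ∑ μ, ∑ ν, f μ ν := Finset.sum_congr rfl fun μ _ => Equiv.sum_comp σ (f μ)
  have h4 : (∑ μ, f (σ μ) (σ μ)) = ∑ μ, f μ μ := Equiv.sum_comp σ (fun μ => f μ μ)
  linarith

end Algebra

/-! ### Axis relabelling of the partition function -/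

section Relabel

variable (ρ : G →* Matrix (Fin n) (Fin n) ℂ) [TopologicalSpace G] [IsTopologicalGroup G] [CompactSpace G]
  [MeasurableSpace G] [BorelSpace G]

/-- **Axis relabelling of the Wilson partition function of the anisotropic torus.**  If a bijection of sites
`e : FinTorusSite a b c d ≃ FinTorusSite a' b' c' d'` intertwines the nearest-neighbour shifts along a
permutation `σ` of the four axes, `e (x.shift μ) = (e x).shift (σ μ)`, then
`Z_{ρ,β}(a,b,c,d) = Z_{ρ,β}(a',b',c',d')` (continuous `ρ`, compact `G`, any real `β`): the link relabelling
`(x, μ) ↦ (e x, σ μ)` preserves the product Haar measure, carries plaquettes to plaquettes up to orientation,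
and `Re tr ρ(g⁻¹) = Re tr ρ(g)`. [cite: MontvayMunster1994, §3.2.6 (3.145)] -/
theorem wilsonFinTorusPartition_relabel (hρ : Continuous ρ) (β : ℝ) {a b c d a' b' c' d' : ℕ}
    (e : FinTorusSite a b c d ≃ FinTorusSite a' b' c' d') (σ : Equiv.Perm (Fin 4))
    (he : ∀ x μ, e (x.shift μ) = (e x).shift (σ μ)) :
    wilsonFinTorusPartition ρ β a b c d = wilsonFinTorusPartition ρ β a' b' c' d' := by
  -- the relabelling of the links and the induced pull-back of configurations
  have hΨ : MeasurePreserving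
      (MeasurableEquiv.arrowCongr' (e.prodCongr σ).symm (MeasurableEquiv.refl G) :
        (FinTorusSite a' b' c' d' × Fin 4 → G) → (FinTorusSite a b c d × Fin 4 → G))
      (Measure.pi fun _ : FinTorusSite a' b' c' d' × Fin 4 => haarProbability G)
      (Measure.pi fun _ : FinTorusSite a b c d × Fin 4 => haarProbability G) :=
    measurePreserving_arrowCongr' (fun _ => haarProbability G) (fun _ => haarProbability G)
      (e.prodCongr σ).symm (MeasurableEquiv.refl G) fun _ => MeasurePreserving.id _
  have hΨU : ∀ U' : FinTorusSite a' b' c' d' × Fin 4 → G,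
      (MeasurableEquiv.arrowCongr' (e.prodCongr σ).symm (MeasurableEquiv.refl G) U' :
        FinTorusSite a b c d × Fin 4 → G) = fun l => U' (e l.1, σ l.2) := fun U' => by
    funext l
    rfl
  unfold wilsonFinTorusPartition
  refine (Eq.trans (integral_congr_ae (ae_of_all _ fun U' => ?_)) (hΨ.integral_comp'
    (fun U : FinTorusSite a b c d × Fin 4 → G => Real.exp (-β * ∑ x : FinTorusSite a b c d,
      ∑ q : {q : Fin 4 × Fin 4 // q.1 < q.2}, ((n : ℝ) - (ρ (finTorusPlaquette U x q.1.1 q.1.2)).trace.re))))).symm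
  rw [hΨU U']
  simp_rw [finTorusPlaquette_relabel e σ he U']
  congr 2
  symm
  calc (∑ x : FinTorusSite a b c d, ∑ q : {q : Fin 4 × Fin 4 // q.1 < q.2},
        ((n : ℝ) - (ρ (finTorusPlaquette U' (e x) (σ q.1.1) (σ q.1.2))).trace.re))
      = ∑ x' : FinTorusSite a' b' c' d', ∑ q : {q : Fin 4 × Fin 4 // q.1 < q.2},
          ((n : ℝ) - (ρ (finTorusPlaquette U' x' (σ q.1.1) (σ q.1.2))).trace.re) :=
        Equiv.sum_comp e (fun x' => ∑ q : {q : Fin 4 × Fin 4 // q.1 < q.2},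
          ((n : ℝ) - (ρ (finTorusPlaquette U' x' (σ q.1.1) (σ q.1.2))).trace.re))
    _ = ∑ x' : FinTorusSite a' b' c' d', ∑ q : {q : Fin 4 × Fin 4 // q.1 < q.2},
          ((n : ℝ) - (ρ (finTorusPlaquette U' x' q.1.1 q.1.2)).trace.re) :=
        Finset.sum_congr rfl fun x' _ =>
          sum_pairs_perm (fun μ ν => (n : ℝ) - (ρ (finTorusPlaquette U' x' μ ν)).trace.re)
            (fun μ ν => by
              show ((n : ℝ) - (ρ (finTorusPlaquette U' x' ν μ)).trace.re) =
                (n : ℝ) - (ρ (finTorusPlaquette U' x' μ ν)).trace.re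
              rw [finTorusPlaquette_symm U' x' μ ν, CompactGroup.re_trace_map_inv ρ hρ]) σ

/-- **`Z(a,b,c,d) = Z(d,b,c,a)`**: exchange of the axes `0` and `3` (site bijection
`(x₀,x₁,x₂,x₃) ↦ (x₃,x₁,x₂,x₀)`; e.g. reading the first side as Euclidean time).
[cite: MontvayMunster1994, §3.2.6 (3.145)] -/
theorem wilsonFinTorusPartition_swap03 (hρ : Continuous ρ) (β : ℝ) (a b c d : ℕ) :
    wilsonFinTorusPartition ρ β a b c d = wilsonFinTorusPartition ρ β d b c a :=
  wilsonFinTorusPartition_relabel ρ hρ β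
    (⟨fun x => (x.2.2.2, x.2.1, x.2.2.1, x.1), fun y => (y.2.2.2, y.2.1, y.2.2.1, y.1), fun _ => rfl, fun _ => rfl⟩ :
      FinTorusSite a b c d ≃ FinTorusSite d b c a)
    (Equiv.swap 0 3) (fun x μ => by fin_cases μ <;> rfl)

/-- **`Z(a,b,c,d) = Z(b,a,c,d)`**: exchange of the axes `0` and `1` (site bijection
`(x₀,x₁,x₂,x₃) ↦ (x₁,x₀,x₂,x₃)`). [cite: MontvayMunster1994, §3.2.6 (3.145)] -/
theorem wilsonFinTorusPartition_swap01 (hρ : Continuous ρ) (β : ℝ) (a b c d : ℕ) :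
    wilsonFinTorusPartition ρ β a b c d = wilsonFinTorusPartition ρ β b a c d :=
  wilsonFinTorusPartition_relabel ρ hρ β
    (⟨fun x => (x.2.1, x.1, x.2.2.1, x.2.2.2), fun y => (y.2.1, y.1, y.2.2.1, y.2.2.2), fun _ => rfl, fun _ => rfl⟩ :
      FinTorusSite a b c d ≃ FinTorusSite b a c d)
    (Equiv.swap 0 1) (fun x μ => by fin_cases μ <;> rfl)

/-- **`Z(a,b,c,d) = Z(c,b,a,d)`**: exchange of the axes `0` and `2` (site bijection
`(x₀,x₁,x₂,x₃) ↦ (x₂,x₁,x₀,x₃)`). [cite: MontvayMunster1994, §3.2.6 (3.145)] -/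
theorem wilsonFinTorusPartition_swap02 (hρ : Continuous ρ) (β : ℝ) (a b c d : ℕ) :
    wilsonFinTorusPartition ρ β a b c d = wilsonFinTorusPartition ρ β c b a d :=
  wilsonFinTorusPartition_relabel ρ hρ β
    (⟨fun x => (x.2.2.1, x.2.1, x.1, x.2.2.2), fun y => (y.2.2.1, y.2.1, y.1, y.2.2.2), fun _ => rfl, fun _ => rfl⟩ :
      FinTorusSite a b c d ≃ FinTorusSite c b a d)
    (Equiv.swap 0 2) (fun x μ => by fin_cases μ <;> rfl)

/-- **Axis symmetry of the Wilson partition function of the anisotropic four-torus** (the three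
transpositions `(0 3)`, `(0 1)`, `(0 2)` of its arguments, which generate all axis permutations): for
continuous `ρ`, compact `G` and every real `β`,
`Z(a,b,c,d) = Z(d,b,c,a)`, `Z(a,b,c,d) = Z(b,a,c,d)`, `Z(a,b,c,d) = Z(c,b,a,d)` for all sides.  Every axis may
thus be read as Euclidean time in the trace formula `Z = Tr 𝕋^T`. [cite: MontvayMunster1994, §3.2.6 (3.145)] -/
theorem wilsonFinTorusPartition_axisSymmetric (hρ : Continuous ρ) (β : ℝ) (a b c d : ℕ) :
    wilsonFinTorusPartition ρ β a b c d = wilsonFinTorusPartition ρ β d b c a ∧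
      wilsonFinTorusPartition ρ β a b c d = wilsonFinTorusPartition ρ β b a c d ∧
        wilsonFinTorusPartition ρ β a b c d = wilsonFinTorusPartition ρ β c b a d :=
  ⟨wilsonFinTorusPartition_swap03 ρ hρ β a b c d, wilsonFinTorusPartition_swap01 ρ hρ β a b c d,
    wilsonFinTorusPartition_swap02 ρ hρ β a b c d⟩

end Relabel

/-! ### Volume (stability) bounds -/

section Volume

variable (ρ : G →* Matrix (Fin n) (Fin n) ℂ) [TopologicalSpace G] [IsTopologicalGroup G] [CompactSpace G]
  [MeasurableSpace G] [BorelSpace G]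

/-- There are six plaquette orientations `μ < ν` in four dimensions. [folklore] -/
private theorem card_pairs_fin_four : Fintype.card {q : Fin 4 × Fin 4 // q.1 < q.2} = 6 := by
  decide

omit [MeasurableSpace G] [BorelSpace G] in
/-- **`0 ≤ S(U) ≤ 12 n · n₀n₁n₂n₃`**: each of the `6 · n₀n₁n₂n₃` plaquette terms of the Wilson action lies in
`[0, 2n]` (`|Re tr ρ(U_p)| ≤ n` for a continuous representation of a compact group).
[cite: MontvayMunster1994, §3.2.2 (3.65)–(3.69) (Wilson action, one orientation per plaquette, "real and positive")] -/
theorem finTorusWilsonAction_nonneg_le (hρ : Continuous ρ) {n₀ n₁ n₂ n₃ : ℕ}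
    (U : FinTorusSite n₀ n₁ n₂ n₃ × Fin 4 → G) :
    0 ≤ finTorusWilsonAction ρ U ∧
      finTorusWilsonAction ρ U ≤ 12 * n * ((n₀ * n₁ * n₂ * n₃ : ℕ) : ℝ) := by
  have hb : ∀ g : G, |((ρ g).trace).re| ≤ n := fun g => by
    simpa [Fintype.card_fin] using CompactGroup.abs_re_trace_le_card ρ hρ g
  refine ⟨Finset.sum_nonneg fun x _ => Finset.sum_nonneg fun q _ => ?_, ?_⟩
  · have := (abs_le.1 (hb (finTorusPlaquette U x q.1.1 q.1.2))).2
    linarith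
  · unfold finTorusWilsonAction
    calc (∑ x : FinTorusSite n₀ n₁ n₂ n₃, ∑ q : {q : Fin 4 × Fin 4 // q.1 < q.2},
          ((n : ℝ) - (ρ (finTorusPlaquette U x q.1.1 q.1.2)).trace.re))
        ≤ ∑ _x : FinTorusSite n₀ n₁ n₂ n₃, ∑ _q : {q : Fin 4 × Fin 4 // q.1 < q.2}, (2 * (n : ℝ)) :=
          Finset.sum_le_sum fun x _ => Finset.sum_le_sum fun q _ => by
            have := (abs_le.1 (hb (finTorusPlaquette U x q.1.1 q.1.2))).1
            linarith
      _ = 12 * n * ((n₀ * n₁ * n₂ * n₃ : ℕ) : ℝ) := by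
          simp only [Finset.sum_const, Finset.card_univ, card_pairs_fin_four, Fintype.card_prod,
            Fintype.card_fin, nsmul_eq_mul, Nat.cast_mul, Nat.cast_ofNat]
          ring

omit [CompactSpace G] [MeasurableSpace G] [BorelSpace G] in
/-- The Wilson weight `exp(−β S)` is continuous in the configuration. [folklore] -/
private theorem continuous_finTorusWeight (hρ : Continuous ρ) (β : ℝ) (n₀ n₁ n₂ n₃ : ℕ) :
    Continuous fun U : FinTorusSite n₀ n₁ n₂ n₃ × Fin 4 → G =>
      Real.exp (-β * finTorusWilsonAction ρ U) := by
  have hU : ∀ l : FinTorusSite n₀ n₁ n₂ n₃ × Fin 4,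
      Continuous fun U : FinTorusSite n₀ n₁ n₂ n₃ × Fin 4 → G => U l := fun l => continuous_apply l
  have hpl : ∀ (x : FinTorusSite n₀ n₁ n₂ n₃) (μ ν : Fin 4),
      Continuous fun U : FinTorusSite n₀ n₁ n₂ n₃ × Fin 4 → G => finTorusPlaquette U x μ ν := fun x μ ν =>
    (((hU _).mul (hU _)).mul (hU _).inv).mul (hU _).inv
  have htr : Continuous fun g : G => (ρ g).trace.re := Complex.continuous_re.comp (Continuous.matrix_trace hρ)
  unfold finTorusWilsonAction
  exact Real.continuous_exp.comp (continuous_const.mul (continuous_finsetSum _ fun x _ =>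
    continuous_finsetSum _ fun q _ => continuous_const.sub (htr.comp (hpl x _ _))))

/-- The partition function as the integral of the weight `exp(−β S)` (unfolding). [folklore] -/
private theorem wilsonFinTorusPartition_eq_integral (β : ℝ) (n₀ n₁ n₂ n₃ : ℕ) :
    wilsonFinTorusPartition ρ β n₀ n₁ n₂ n₃ =
      ∫ U, Real.exp (-β * finTorusWilsonAction ρ U)
        ∂(Measure.pi fun _ : FinTorusSite n₀ n₁ n₂ n₃ × Fin 4 => haarProbability G) := by
  rfl

variable [SecondCountableTopology G]

/-- **`Z ≤ 1` for `β ≥ 0`**: the weight `exp(−β S) ≤ 1` (`S ≥ 0`) integrated against a probability measure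
(`G` second countable, e.g. a closed subgroup of `U(N)` — every `G` with a faithful finite-dimensional continuous
representation). [cite: MontvayMunster1994, §3.2.2 (3.65)–(3.69) (Wilson action, one orientation per plaquette, "real and positive")] -/
theorem wilsonFinTorusPartition_le_one_of_nonneg (hρ : Continuous ρ) {β : ℝ} (hβ : 0 ≤ β)
    (n₀ n₁ n₂ n₃ : ℕ) : wilsonFinTorusPartition ρ β n₀ n₁ n₂ n₃ ≤ 1 := by
  rw [wilsonFinTorusPartition_eq_integral]
  have hle : ∀ U : FinTorusSite n₀ n₁ n₂ n₃ × Fin 4 → G, Real.exp (-β * finTorusWilsonAction ρ U) ≤ 1 :=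
    fun U => Real.exp_le_one_iff.2 (by
      have := (finTorusWilsonAction_nonneg_le ρ hρ U).1
      nlinarith)
  have hint : Integrable (fun U : FinTorusSite n₀ n₁ n₂ n₃ × Fin 4 → G =>
      Real.exp (-β * finTorusWilsonAction ρ U))
      (Measure.pi fun _ : FinTorusSite n₀ n₁ n₂ n₃ × Fin 4 => haarProbability G) :=
    (continuous_finTorusWeight ρ hρ β n₀ n₁ n₂ n₃).integrable_of_hasCompactSupport
      (IsCompact.of_isClosed_subset isCompact_univ (isClosed_tsupport _) (Set.subset_univ _))
  calc ∫ U, Real.exp (-β * finTorusWilsonAction ρ U)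
        ∂(Measure.pi fun _ : FinTorusSite n₀ n₁ n₂ n₃ × Fin 4 => haarProbability G)
      ≤ ∫ _U, (1 : ℝ) ∂(Measure.pi fun _ : FinTorusSite n₀ n₁ n₂ n₃ × Fin 4 => haarProbability G) :=
        integral_mono hint (integrable_const 1) hle
    _ = 1 := by simp

/-- **`exp(−12 n β · n₀n₁n₂n₃) ≤ Z` for `β ≥ 0`**: the weight is bounded below by `exp(−β S_max)`,
`S ≤ 12 n · n₀n₁n₂n₃`, and the links carry a probability measure (`G` second countable).
[cite: MontvayMunster1994, §3.2.2 (3.65)–(3.69) (Wilson action, one orientation per plaquette, "real and positive")] -/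
theorem exp_neg_le_wilsonFinTorusPartition (hρ : Continuous ρ) {β : ℝ} (hβ : 0 ≤ β) (n₀ n₁ n₂ n₃ : ℕ) :
    Real.exp (-(12 * n * β * ((n₀ * n₁ * n₂ * n₃ : ℕ) : ℝ))) ≤ wilsonFinTorusPartition ρ β n₀ n₁ n₂ n₃ := by
  rw [wilsonFinTorusPartition_eq_integral]
  have hge : ∀ U : FinTorusSite n₀ n₁ n₂ n₃ × Fin 4 → G,
      Real.exp (-(12 * n * β * ((n₀ * n₁ * n₂ * n₃ : ℕ) : ℝ))) ≤ Real.exp (-β * finTorusWilsonAction ρ U) :=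
    fun U => Real.exp_le_exp.2 (by
      have := (finTorusWilsonAction_nonneg_le ρ hρ U).2
      nlinarith)
  have hint : Integrable (fun U : FinTorusSite n₀ n₁ n₂ n₃ × Fin 4 → G =>
      Real.exp (-β * finTorusWilsonAction ρ U))
      (Measure.pi fun _ : FinTorusSite n₀ n₁ n₂ n₃ × Fin 4 => haarProbability G) :=
    (continuous_finTorusWeight ρ hρ β n₀ n₁ n₂ n₃).integrable_of_hasCompactSupport
      (IsCompact.of_isClosed_subset isCompact_univ (isClosed_tsupport _) (Set.subset_univ _))
  calc Real.exp (-(12 * n * β * ((n₀ * n₁ * n₂ * n₃ : ℕ) : ℝ)))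
      = ∫ _U, Real.exp (-(12 * n * β * ((n₀ * n₁ * n₂ * n₃ : ℕ) : ℝ)))
          ∂(Measure.pi fun _ : FinTorusSite n₀ n₁ n₂ n₃ × Fin 4 => haarProbability G) := by simp
    _ ≤ ∫ U, Real.exp (-β * finTorusWilsonAction ρ U)
          ∂(Measure.pi fun _ : FinTorusSite n₀ n₁ n₂ n₃ × Fin 4 => haarProbability G) :=
        integral_mono (integrable_const _) hint hge

/-- **Volume bounds `exp(−A·n₀n₁n₂n₃) ≤ Z ≤ 1`, `A = 12 n β`**, for `β ≥ 0`, continuous `ρ`, compact `G`, and all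
sides (packaged form of the two stability bounds).
[cite: MontvayMunster1994, §3.2.2 (3.65)–(3.69) (Wilson action, one orientation per plaquette, "real and positive")] -/
theorem wilsonFinTorusPartition_volumeBounds (hρ : Continuous ρ) {β : ℝ} (hβ : 0 ≤ β) :
    ∃ A : ℝ, ∀ n₀ n₁ n₂ n₃ : ℕ,
      Real.exp (-(A * ((n₀ * n₁ * n₂ * n₃ : ℕ) : ℝ))) ≤ wilsonFinTorusPartition ρ β n₀ n₁ n₂ n₃ ∧
        wilsonFinTorusPartition ρ β n₀ n₁ n₂ n₃ ≤ 1 := by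
  exact ⟨12 * n * β, fun n₀ n₁ n₂ n₃ => ⟨exp_neg_le_wilsonFinTorusPartition ρ hρ hβ n₀ n₁ n₂ n₃,
    wilsonFinTorusPartition_le_one_of_nonneg ρ hρ hβ _ _ _ _⟩⟩

end Volume

end Literature.MathematicalPhysics.QuantumFieldTheory
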